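import Summits.ResolutionOfSingularities.ResolutionOfSingularities.Theorems.EquisingularLiftEquisingularLiftNatDirectionTransport
import Summits.ResolutionOfSingularities.ResolutionOfSingularities.Theorems.EquisingularLiftEquisingularLiftNatDirectionFrames
import Literature.AlgebraicGeometry.HodgeTheory.RegularImmersionConormalBasis
import Literature.AlgebraicGeometry.Modules.PullbackFrame
import Literature.AlgebraicGeometry.Resolution.StrictTransformIsBlowup
import HarnessLib

/-!
# [OURS · L1 W4.5b · T-DIRLIFT-UP route C, brick C1c part 1] Chart data of a direction: conormal frame upstairs, coefficients downstairs

Cell res-hironaka, LADDER-RESOLUTION rung L, slot W4.5(b), crux chain w45b (EL♮(3) = stmt-ResolutionOfSingularities-20148); object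
T-DIRLIFT-UP (res-L1-w45b-plan-1 RULING 19:14:55Z, route C), brick C1c (`L/res-D-pv-051/TARGET-C1c.sig.lean` b928b225abc4a457), part 1.
`--supports stmt-ResolutionOfSingularities-20148 --as helper`. THEOREMS ONLY; def-free; NOT a statement of any manuscript; AI-written,
AI review weaker than expert review.

WHAT. `exists_directionChartData`: at a point `y ∈ V(Ī)` (`Ī = I·𝒪_{G₀}` the trace of the in-carrier curve `C = V(I)`, `C ↪ X₀` a regular
immersion of codimension 2) lying over a point of `C`, there are: an affine `V ⊆ X₀` with a weakly regular pair `x` generating `I(V)`,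
sections `s_j ∈ Γ(V, 𝓘)` reading to `x_j`, a conormal FRAME `e : 𝒪² ≅ 𝒞|_{ι_C⁻¹V}` whose basis sections are `η(s_j)` (C1d p564232 +
B2 p566180), and an affine `W ∋ y` below `j₀⁻¹V` carrying direction coordinates `α` (unimodular mod `Ī(W)` with witness `a`) with
`Ī(W) = (j₀♯x₀, j₀♯x₁)` and `𝒟'(W) = (Σ α_j · j₀♯x_j) + Ī(W)²` (B5). Also `exists_changeOfGenerators` (two charts: `x′ = N x` on an
affine below both) and `map_basisSection_eq_sum_of_changeOfGenerators` (the induced relation of the doubly pulled-back conormal frames,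
B7 `map_unitSection_eq_sum` three times).
-/

noncomputable section

open CategoryTheory CategoryTheory.Limits AlgebraicGeometry Opposite TopologicalSpace
open Literature.AlgebraicGeometry.Modules Literature.AlgebraicGeometry.Morphisms
open Literature.AlgebraicGeometry.Deformation Literature.AlgebraicGeometry.Motives
open Literature.AlgebraicGeometry.HodgeTheory Literature.AlgebraicGeometry.Resolution
open Summit.ResolutionOfSingularities.ResolutionOfSingularities.Cruxes.EquisingularLiftNat.Sections

set_option linter.dupNamespace false -- mandated namespace `Summit.<Summit>.<Problem>` of this single-conjunct summit

namespace Summit.ResolutionOfSingularities.ResolutionOfSingularities.Cruxes.EquisingularLiftNat.P1VB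

/-- Restricting an `appLE` value along affine opens. [folklore] -/
theorem secRes_appLE {X₀ G₀ : Scheme.{0}} (j₀ : G₀ ⟶ X₀) (V : X₀.Opens) {W₀ W : G₀.Opens} (hW : W ≤ W₀) (e : W₀ ≤ j₀ ⁻¹ᵁ V)
    (t : Γ(X₀, V)) : secRes G₀ hW (j₀.appLE V W₀ e t) = j₀.appLE V W (hW.trans e) t := by
  change (j₀.appLE V W₀ e ≫ G₀.presheaf.map (homOfLE hW).op) t = _
  rw [Scheme.Hom.appLE_map]

/-- `List.ofFn` of a pair. [folklore] -/
theorem list_ofFn_pair {R : Type} (a b : R) : List.ofFn ![a, b] = [a, b] := by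
  simp [List.ofFn_succ]

/-- **Chart data of a direction at a point of the carrier.** See the module docstring. [OURS · planning text of w45b route C] -/
theorem exists_directionChartData {X₀ G₀ : Scheme.{0}} (j₀ : G₀ ⟶ X₀) [IsLocallyNoetherian X₀] [IsLocallyNoetherian G₀]
    (I : X₀.IdealSheafData) (hri : IsRegularImmersionOfCodim I.subschemeι 2)
    (Ī : G₀.IdealSheafData) (hĪ : I.comap j₀ = Ī) (𝒟' : G₀.IdealSheafData)
    (hdir' : ∀ z ∈ Ī.support, ∃ c : Fin 2 → G₀.presheaf.stalk z,
      Ideal.span (Set.range c) = stalkIdeal Ī z ∧ IsQuasiRegular c ∧ stalkIdeal 𝒟' z = Ideal.span {c 0} ⊔ Ideal.span {c 1 * c 1})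
    (y : G₀) (hyS : y ∈ Ī.support) (z : I.subscheme) (hz : j₀ y = I.subschemeι z) :
    ∃ (V : X₀.affineOpens) (x : Fin 2 → Γ(X₀, (V : X₀.Opens))) (s : Fin 2 → Γ(idealModule I.subschemeι, (V : X₀.Opens)))
      (_ : RingTheory.Sequence.IsWeaklyRegular Γ(X₀, (V : X₀.Opens)) (List.ofFn x))
      (_ : Ideal.span (Set.range x) = I.ideal V)
      (_ : ∀ j, toRing (idealModuleι I.subschemeι) (V : X₀.Opens) (s j) = x j)
      (e : SheafOfModules.free (Fin 2) ≅ (conormalSheaf I.subschemeι).over (I.subschemeι ⁻¹ᵁ (V : X₀.Opens)))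
      (_ : ∀ j, basisSection e j = unitSectionLE I.subschemeι (idealModule I.subschemeι) (le_refl _) (s j))
      (W : G₀.affineOpens) (hWV : (W : G₀.Opens) ≤ j₀ ⁻¹ᵁ (V : X₀.Opens)) (_ : y ∈ (W : G₀.Opens))
      (α a : Fin 2 → Γ(G₀, (W : G₀.Opens))),
      (∑ j, a j * α j - 1) ∈ Ī.ideal W ∧
      Ī.ideal W = Ideal.span (Set.range fun j => j₀.appLE (V : X₀.Opens) W hWV (x j)) ∧
      𝒟'.ideal W = Ideal.span {∑ j, α j * j₀.appLE (V : X₀.Opens) W hWV (x j)} ⊔ (Ī.ideal W) ^ 2 := by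
  classical
  haveI : IsClosedImmersion I.subschemeι := inferInstance
  obtain ⟨V, hzV, rs, hlen, hreg, hIV⟩ := hri.2 z
  obtain ⟨x0, x1, rfl⟩ := List.length_eq_two.mp hlen
  have hreg' : RingTheory.Sequence.IsWeaklyRegular Γ(X₀, (V : X₀.Opens)) (List.ofFn ![x0, x1]) := by
    rw [list_ofFn_pair]; exact hreg
  have hspan : Ideal.span (Set.range ![x0, x1]) = I.ideal V := by
    have h : I.ideal V = Ideal.ofList [x0, x1] := by
      rw [hIV, Scheme.IdealSheafData.ker_subschemeι]
    rw [h, span_range_fin_two, Ideal.ofList_cons, Ideal.ofList_singleton, Ideal.span_insert]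
    rfl
  have hspan' : Ideal.span (Set.range ![x0, x1]) = I.subschemeι.ker.ideal V := by
    rw [Scheme.IdealSheafData.ker_subschemeι]; exact hspan
  obtain ⟨s, b, hs, hb⟩ := exists_basis_sections_pullback_idealModule_eq I.subschemeι V ![x0, x1] hreg' hspan'
  obtain ⟨e₀⟩ := nonempty_free_iso_over_of_basis (conormalSheaf I.subschemeι) (coh_conormalSheaf I.subschemeι).loc
    (V.2.preimage I.subschemeι) b
  obtain ⟨e, he⟩ := exists_frame_of_basis e₀ b
  -- downstairs
  have hyV : y ∈ j₀ ⁻¹ᵁ (V : X₀.Opens) := by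
    change j₀ y ∈ (V : X₀.Opens)
    rw [hz]; exact hzV
  obtain ⟨W₀', hW₀', hyW₀, hW₀V⟩ := exists_isAffineOpen_mem_and_subset hyV
  let W₀ : G₀.affineOpens := ⟨W₀', hW₀'⟩
  have hW₀V' : (W₀ : G₀.Opens) ≤ j₀ ⁻¹ᵁ (V : X₀.Opens) := hW₀V
  let ℓ : Fin 2 → Γ(G₀, (W₀ : G₀.Opens)) := fun j => j₀.appLE (V : X₀.Opens) W₀ hW₀V' (![x0, x1] j)
  have hℓ : Ī.ideal W₀ = Ideal.span (Set.range ℓ) := by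
    rw [← hĪ, ideal_comap_eq_map_of_le j₀ I V W₀ hW₀V', ← hspan, Ideal.map_span, ← Set.range_comp]
    rfl
  obtain ⟨W, hW, hyW, α, a, hu, h𝒟⟩ := exists_direction_coords_on_chart Ī 𝒟' W₀ hyW₀ hyS ℓ hℓ (hdir' y hyS)
  have hℓW : ∀ j, secRes G₀ hW (ℓ j) = j₀.appLE (V : X₀.Opens) W (hW.trans hW₀V') (![x0, x1] j) := fun j =>
    secRes_appLE j₀ V hW hW₀V' _
  refine ⟨V, ![x0, x1], s, hreg', hspan, hs, e, fun j => (he j).trans (hb j), W, hW.trans hW₀V', hyW, α, a, hu, ?_, ?_⟩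
  · rw [← map_secRes_ideal Ī hW, hℓ, Ideal.map_span, ← Set.range_comp]
    congr 1
    exact congrArg Set.range (funext hℓW)
  · rw [h𝒟]
    simp_rw [hℓW]


/-- **Change of generators on a common affine.** Two generating pairs `x`, `x′` of `I` on affine opens `V`, `V′` are related by
`x′_j = Σ_l N_{jl} x_l` on any affine `V″` below both. [folklore] -/
theorem exists_changeOfGenerators {X₀ : Scheme.{0}} (I : X₀.IdealSheafData) {V V' V'' : X₀.affineOpens}
    (h : (V'' : X₀.Opens) ≤ V) (h' : (V'' : X₀.Opens) ≤ V') (x : Fin 2 → Γ(X₀, (V : X₀.Opens)))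
    (x' : Fin 2 → Γ(X₀, (V' : X₀.Opens))) (hx : Ideal.span (Set.range x) = I.ideal V)
    (hx' : Ideal.span (Set.range x') = I.ideal V') :
    ∃ N : Fin 2 → Fin 2 → Γ(X₀, (V'' : X₀.Opens)), ∀ j, secRes X₀ h' (x' j) = ∑ l, N j l * secRes X₀ h (x l) := by
  classical
  have hV'' : I.ideal V'' = Ideal.span (Set.range fun l => secRes X₀ h (x l)) := by
    rw [← map_secRes_ideal I h, ← hx, Ideal.map_span, ← Set.range_comp]
    rfl
  have hmem : ∀ j, secRes X₀ h' (x' j) ∈ Ideal.span (Set.range fun l => secRes X₀ h (x l)) := by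
    intro j
    rw [← hV'', ← map_secRes_ideal I h']
    exact Ideal.mem_map_of_mem _ (hx' ▸ Ideal.subset_span ⟨j, rfl⟩)
  choose N hN using fun j => Ideal.mem_span_range_iff_exists_fun.mp (hmem j)
  exact ⟨N, fun j => (hN j).symm⟩

/-- Restricted basis sections of a conormal frame built on `η(s_j)` are restricted unit sections. [folklore] -/
theorem map_basisSection_conormalFrame {X₀ : Scheme.{0}} (I : X₀.IdealSheafData) {V : X₀.affineOpens} {B : (I.subscheme).Opens}
    (s : Fin 2 → Γ(idealModule I.subschemeι, (V : X₀.Opens)))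
    (e : SheafOfModules.free (Fin 2) ≅ (conormalSheaf I.subschemeι).over (I.subschemeι ⁻¹ᵁ (V : X₀.Opens)))
    (he : ∀ j, basisSection e j = unitSectionLE I.subschemeι (idealModule I.subschemeι) (le_refl _) (s j))
    (k : B ⟶ I.subschemeι ⁻¹ᵁ (V : X₀.Opens)) (l : Fin 2) :
    (conormalSheaf I.subschemeι).presheaf.map k.op (basisSection e l) =
      ((Scheme.Modules.pullback I.subschemeι).obj (idealModule I.subschemeι)).presheaf.map k.op
        (unitSection I.subschemeι (idealModule I.subschemeι) (V : X₀.Opens) (s l)) := by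
  rw [he, unitSectionLE]
  change ((Scheme.Modules.pullback I.subschemeι).obj (idealModule I.subschemeι)).presheaf.map k.op
    (((Scheme.Modules.pullback I.subschemeι).obj (idealModule I.subschemeι)).presheaf.map (homOfLE (le_refl _)).op _) = _
  rw [presheaf_map_map, Subsingleton.elim (k ≫ homOfLE (le_refl _)) k]

/-- **The change of generators pulls back to the conormal frames.** With chart data `(V, x, s, e)`, `(V′, x′, s′, e′)` and
`x′_j = Σ_l N_{jl} x_l` on an affine `V″` below both, the basis sections of the doubly pulled-back conormal frames satisfy
`b′_j| = Σ_l (g♯ε♯ι_C♯ N_{jl}) · b_l|` over `g⁻¹ε⁻¹ι_C⁻¹V″`. [cite: Hartshorne1977, II.5 (p. 110)] -/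
theorem map_basisSection_eq_sum_of_changeOfGenerators {X₀ Y Y' : Scheme.{0}} (I : X₀.IdealSheafData)
    (ε : Y ⟶ I.subscheme) (g : Y' ⟶ Y) {V V' V'' : X₀.affineOpens} (h : (V'' : X₀.Opens) ≤ V) (h' : (V'' : X₀.Opens) ≤ V')
    (x : Fin 2 → Γ(X₀, (V : X₀.Opens))) (x' : Fin 2 → Γ(X₀, (V' : X₀.Opens)))
    (s : Fin 2 → Γ(idealModule I.subschemeι, (V : X₀.Opens))) (s' : Fin 2 → Γ(idealModule I.subschemeι, (V' : X₀.Opens)))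
    (hs : ∀ j, toRing (idealModuleι I.subschemeι) (V : X₀.Opens) (s j) = x j)
    (hs' : ∀ j, toRing (idealModuleι I.subschemeι) (V' : X₀.Opens) (s' j) = x' j)
    (e : SheafOfModules.free (Fin 2) ≅ (conormalSheaf I.subschemeι).over (I.subschemeι ⁻¹ᵁ (V : X₀.Opens)))
    (e' : SheafOfModules.free (Fin 2) ≅ (conormalSheaf I.subschemeι).over (I.subschemeι ⁻¹ᵁ (V' : X₀.Opens)))
    (he : ∀ j, basisSection e j = unitSectionLE I.subschemeι (idealModule I.subschemeι) (le_refl _) (s j))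
    (he' : ∀ j, basisSection e' j = unitSectionLE I.subschemeι (idealModule I.subschemeι) (le_refl _) (s' j))
    (N : Fin 2 → Fin 2 → Γ(X₀, (V'' : X₀.Opens))) (hN : ∀ j, secRes X₀ h' (x' j) = ∑ l, N j l * secRes X₀ h (x l)) (j : Fin 2) :
    ((Scheme.Modules.pullback g).obj ((Scheme.Modules.pullback ε).obj (conormalSheaf I.subschemeι))).presheaf.map
        ((Opens.map g.base).map ((Opens.map ε.base).map ((Opens.map I.subschemeι.base).map (homOfLE h')))).op
        (basisSection (E := (Scheme.Modules.pullback g).obj ((Scheme.Modules.pullback ε).obj (conormalSheaf I.subschemeι)))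
          (pullbackFrame g (pullbackFrame ε e')) j) =
      ∑ l, g.app _ (ε.app _ (I.subschemeι.app (V'' : X₀.Opens) (N j l))) •
        ((Scheme.Modules.pullback g).obj ((Scheme.Modules.pullback ε).obj (conormalSheaf I.subschemeι))).presheaf.map
          ((Opens.map g.base).map ((Opens.map ε.base).map ((Opens.map I.subschemeι.base).map (homOfLE h)))).op
          (basisSection (E := (Scheme.Modules.pullback g).obj ((Scheme.Modules.pullback ε).obj (conormalSheaf I.subschemeι)))
            (pullbackFrame g (pullbackFrame ε e)) l) := by
  classical
  -- (c) the relation among the sections `s`, `s'` of the ideal module over `V''`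
  have hsrel : (idealModule I.subschemeι).presheaf.map (homOfLE h').op (s' j) =
      ∑ l, N j l • (idealModule I.subschemeι).presheaf.map (homOfLE h).op (s l) := by
    apply kernel_ι_app_injective (structureModuleMap I.subschemeι) (V'' : X₀.Opens)
    change toRing (idealModuleι I.subschemeι) (V'' : X₀.Opens) _ = toRing (idealModuleι I.subschemeι) (V'' : X₀.Opens) _
    rw [← map_toRing, hs']
    change secRes X₀ h' (x' j) = ((idealModuleι I.subschemeι).app (V'' : X₀.Opens)).hom (∑ l, N j l • _)
    rw [map_sum, hN]
    refine Finset.sum_congr rfl fun l _ => ?_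
    change _ = toRing (idealModuleι I.subschemeι) (V'' : X₀.Opens) (N j l • _)
    rw [toRing_smul, ← map_toRing, hs]
  -- (d) pull back along `ι_C`
  have R1 := map_unitSection_eq_sum I.subschemeι (idealModule I.subschemeι) (homOfLE h) (homOfLE h') s (s' j) (N j) hsrel
  have R1' : (conormalSheaf I.subschemeι).presheaf.map ((Opens.map I.subschemeι.base).map (homOfLE h')).op (basisSection e' j) =
      ∑ l, I.subschemeι.app (V'' : X₀.Opens) (N j l) •
        (conormalSheaf I.subschemeι).presheaf.map ((Opens.map I.subschemeι.base).map (homOfLE h)).op (basisSection e l) := by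
    rw [map_basisSection_conormalFrame I s' e' he', R1]
    refine Finset.sum_congr rfl fun l _ => ?_
    rw [map_basisSection_conormalFrame I s e he]
    rfl
  -- (e) pull back along `ε`
  have R2 := map_unitSection_eq_sum ε (conormalSheaf I.subschemeι) ((Opens.map I.subschemeι.base).map (homOfLE h))
    ((Opens.map I.subschemeι.base).map (homOfLE h')) (basisSection e) (basisSection e' j) _ R1'
  simp_rw [← basisSection_pullbackFrame] at R2
  -- (f) pull back along `g`
  have R3 := map_unitSection_eq_sum g ((Scheme.Modules.pullback ε).obj (conormalSheaf I.subschemeι))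
    ((Opens.map ε.base).map ((Opens.map I.subschemeι.base).map (homOfLE h)))
    ((Opens.map ε.base).map ((Opens.map I.subschemeι.base).map (homOfLE h')))
    (basisSection (E := (Scheme.Modules.pullback ε).obj (conormalSheaf I.subschemeι)) (pullbackFrame ε e))
    (basisSection (E := (Scheme.Modules.pullback ε).obj (conormalSheaf I.subschemeι)) (pullbackFrame ε e') j) _ R2
  simp_rw [← basisSection_pullbackFrame] at R3
  exact R3

end Summit.ResolutionOfSingularities.ResolutionOfSingularities.Cruxes.EquisingularLiftNat.P1VB

end
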